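import Literature.NumberTheory.EllipticCurves.X049TwistMinimalModelProofs
import Literature.NumberTheory.EllipticCurves.X049TwistCMSigmaSqTwoProofs
import Literature.NumberTheory.EllipticCurves.PadicSigmaSqVariableChangeProofs
import Literature.NumberTheory.EllipticCurves.Cm7QuadraticTwistGoodAtTwo
import Literature.NumberTheory.EllipticCurves.GlobalMinimalModel
import Literature.NumberTheory.EllipticCurves.PadicFormalLogOrder
import HarnessLib

/-!
# Road (C) `disegni-pair-two` on crux stmt-BirchSwinnertonDyer-20368 — FRAME: the sigma-squared pair of ANY minimal good partner

LEAD `bsd-line-cf2-p1` g22 (skeleton v3.6 of `Lines/disegni_pair_two.lean`). The nine-prints ticket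
`DisegniPairTwo.disegniGZ_pair_two_of_nine_prints` (-w8 g27, pen SUMMON 2026-08-31T03:16:55Z (B2)) consumes, in each
`d`-block, the hypothesis `∃ Sq c, (V.baseChange ℚ_[2]).IsMazurTateSigmaSqPair Sq c` for the frame's good partner `V`
(fed to the PIN theorem `pairing_eq_minusTwist_pairing_of_pair`, -w8 g26). The frame theorem `frame_chi8_two_fixing`
exposes `V` only as «a globally minimal model with `C₁ • V = 49a1^{(d′)}`», not as the literal integral model `W_k`;
this file supplies the pair for EVERY such `V`: two globally minimal models of one curve differ by `u = ±1`,
`r, s, t ∈ ℤ` (`isGloballyMinimal_unique_holds`), and the sigma-squared pair transports along `2`-integral changes of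
variables (`exists_isMazurTateSigmaSqPair_of_variableChange`) from `W_k ⊗ ℚ₂`, where it is the square of the CM sigma
function (`cm7Twist_exists_isMazurTateSigmaSqPair_two`). THEOREMS ONLY; no `sorry`; no new definitions.
BSD is not proved by any of this; 20368 is not closed here.
-/

set_option linter.dupNamespace false

noncomputable section

open scoped Classical

open WeierstrassCurve Literature.NumberTheory.EllipticCurves

namespace Summit.BirchSwinnertonDyer.BirchSwinnertonDyer.Theorems.PrintCf2.DisegniPairTwo

/-- Base change of an INTEGRAL change of variables with `u = ±1` to `ℚ₂` is `2`-integral with `u ∈ ℤ₂ˣ`.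
[cite: SilvermanAEC2009, VII.1.3(b)] -/
theorem variableChange_map_padic_integral {p : ℕ} [Fact p.Prime] (D : VariableChange ℚ)
    (hu : D.u = 1 ∨ D.u = -1) {r s t : ℤ} (hr : D.r = r) (hs : D.s = s) (ht : D.t = t) :
    ‖((D.map (algebraMap ℚ ℚ_[p])).u : ℚ_[p])‖ = 1 ∧ ‖(D.map (algebraMap ℚ ℚ_[p])).r‖ ≤ 1 ∧
      ‖(D.map (algebraMap ℚ ℚ_[p])).s‖ ≤ 1 ∧ ‖(D.map (algebraMap ℚ ℚ_[p])).t‖ ≤ 1 := by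
  refine ⟨?_, ?_, ?_, ?_⟩
  · show ‖(algebraMap ℚ ℚ_[p] (D.u : ℚ))‖ = 1
    rcases hu with h | h <;> simp [h]
  · show ‖algebraMap ℚ ℚ_[p] D.r‖ ≤ 1
    rw [hr]; simpa using Padic.norm_int_le_one (p := p) r
  · show ‖algebraMap ℚ ℚ_[p] D.s‖ ≤ 1
    rw [hs]; simpa using Padic.norm_int_le_one (p := p) s
  · show ‖algebraMap ℚ ℚ_[p] D.t‖ ≤ 1
    rw [ht]; simpa using Padic.norm_int_le_one (p := p) t

/-- **Every globally minimal model `V` of `49a1^{(d′)}`, `d′ ≡ 1 (mod 4)` squarefree, carries a sigma-squared pair at `2`.**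
`V` and the integral model `W_k = [1, −(3k+1), 0, −2d′², −d′³]` (`d′ = 4k+1`) are globally minimal models of the same
curve, so `D • V = W_k` with `u = ±1`, `r, s, t ∈ ℤ`; the pair of `W_k ⊗ ℚ₂` (square of the CM sigma function) transports
to `V ⊗ ℚ₂` along `D`. [cite: MazurTate1991, Thm. 3.1] [cite: Silverman2005DivPoly, §5 Rem. 2]
[cite: Perrinriou1984, Ch. III §1.2 Lemme 2] [cite: SilvermanAEC2009, VII.1.3(b) and VIII.8.3] -/
theorem exists_isMazurTateSigmaSqPair_two_of_smul_eq_cm7_quadraticTwist {d' : ℤ} (hd4 : d' % 4 = 1)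
    (hsq : Squarefree d') (V : WeierstrassCurve ℚ) [V.IsElliptic] [V.IsGloballyMinimal]
    (C₁ : VariableChange ℚ) (hC₁ : C₁ • V = cm7.quadraticTwist (d' : ℚ)) :
    ∃ Sq : PowerSeries ℚ_[2], ∃ c : ℚ_[2], (V.baseChange ℚ_[2]).IsMazurTateSigmaSqPair Sq c := by
  obtain ⟨k, rfl⟩ : ∃ k : ℤ, d' = 4 * k + 1 := ⟨d' / 4, by omega⟩
  set Wk : WeierstrassCurve ℚ :=
    ⟨1, -(3 * (k : ℚ) + 1), 0, -2 * (4 * (k : ℚ) + 1) ^ 2, -(4 * (k : ℚ) + 1) ^ 3⟩ with hWk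
  set A : VariableChange ℚ := ⟨1, 0, 1 / 2, 0⟩ with hA
  have hAV : A • cm7.quadraticTwist (((4 * k + 1 : ℤ)) : ℚ) = Wk := by
    rw [hA, cm7_quadraticTwist_smul_eq k]
    ext <;> simp [WeierstrassCurve.map, hWk]
  haveI : Wk.IsElliptic := cm7Twist_isElliptic Wk k hWk
  haveI hWkmin : Wk.IsGloballyMinimal := cm7Twist_isGloballyMinimal_of_squarefree Wk k hWk hsq
  -- `D • V = W_k`
  set D : VariableChange ℚ := A * C₁ with hD
  have hDV : D • V = Wk := by rw [hD, mul_smul, hC₁, hAV]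
  haveI : (D • V).IsGloballyMinimal := by rw [hDV]; exact hWkmin
  obtain ⟨hu, r, s, t, hr, hs, ht⟩ := isGloballyMinimal_unique_holds V D
  obtain ⟨hu', hr', hs', ht'⟩ := variableChange_map_padic_integral (p := 2) D hu hr hs ht
  -- transport the pair of `W_k ⊗ ℚ₂` along the `2`-integral change `D ⊗ ℚ₂`
  refine exists_isMazurTateSigmaSqPair_of_variableChange (V := V.baseChange ℚ_[2])
    (vc := D.map (algebraMap ℚ ℚ_[2])) hu' hr' hs' ht' ?_
  have hmap : (D.map (algebraMap ℚ ℚ_[2])) • V.baseChange ℚ_[2] = Wk.baseChange ℚ_[2] := by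
    rw [WeierstrassCurve.baseChange, WeierstrassCurve.map_variableChange, hDV]; rfl
  rw [hmap]
  exact cm7Twist_exists_isMazurTateSigmaSqPair_two Wk k hWk

end Summit.BirchSwinnertonDyer.BirchSwinnertonDyer.Theorems.PrintCf2.DisegniPairTwo

end
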